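import Mathlib
import HarnessLib

/-!
# One-units of `ℚ_p`: `‖(1+t)^p − 1‖ = ‖pt‖`, and RIGIDITY of homomorphisms out of `1 + pℤ_p`
# that are tangent to zero to second order (proofs only)

Topic `Literature/NumberTheory/LocalFields`. Pure proofs, Mathlib only. The printed anchor is the
structure of the one-units `U₁ = 1 + pℤ_p` (F. Gouvêa, *p-adic Numbers*, §5.8, Prop. 5.8.1:
`log_p : U_p ⥲ pℤ_p` is an isometric isomorphism, `U_p ≅ ℤ_p^+` torsion-free pro-`p`; its proof runs
on the binomial estimate for `(1+t)^p`). We record the estimate and the following standard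
consequence, in the elementary form in which it is USED (cell `bsd-eis`, seat `bsd-eis-k5-c4` g3:
identification of the formal logarithm of a Tate curve along Tate's parametrisation with `log_p`,
and of `cosh ∘ log_p` with `(u + u⁻¹)/2`, inputs (T2e)/(T2f) of the discharge of
`SteinWuthrich2013.exists_isSplitMultCanonical`, crux 4 `BSDpOnCellC` of route `EisensteinPrimes`):

* `norm_one_add_pow_sub_one_le` — `‖(1+t)^k − 1‖ ≤ ‖t‖` for `‖t‖ ≤ 1`, any `k`;
* `norm_one_add_pow_sub_one_sub_le` — `‖(1+t)^k − 1 − kt‖ ≤ ‖t‖²` for `‖t‖ ≤ 1`;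
* `norm_one_add_pow_prime_sub_one_le` — `‖(1+t)^p − 1‖ ≤ p⁻¹‖t‖` for `‖t‖ ≤ p⁻¹` (any `p`);
* `norm_one_add_pow_prime_sub_one_eq` — `‖(1+t)^p − 1‖ = p⁻¹‖t‖` for `‖t‖ ≤ p⁻¹`, `p ≠ 2`;
* `norm_one_add_pow_prime_pow_sub_one_le/eq` — the iterates for `(1+t)^{pⁿ}`;
* `eq_zero_of_mul_hom_of_norm_le_sq` — **additive rigidity**: a map `f` with
  `f(uv) = f(u) + f(v)` on the ball `‖u − 1‖ ≤ p⁻¹` and `‖f(u)‖ ≤ K‖u − 1‖²` there vanishes on the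
  ball (`pⁿ f(u) = f(u^{pⁿ})` and `‖u^{pⁿ} − 1‖ ≤ p⁻ⁿ‖u − 1‖`);
* `eq_one_of_mul_hom_of_norm_sub_one_le_sq` — **multiplicative rigidity** (`p ≠ 2`): a map `R` with
  `R(uv) = R(u)R(v)` on the ball, `‖R(u) − 1‖ ≤ p⁻¹` and `‖R(u) − 1‖ ≤ K‖u − 1‖²` there is `≡ 1` on
  the ball (`‖r^{pⁿ} − 1‖ = p⁻ⁿ‖r − 1‖`).

## Sources

* F. Q. Gouvêa, *p-adic Numbers: An Introduction* (Universitext, 1993), §5.7 (Lemma 5.7.4,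
  Prop. 5.7.8) and §5.8, Prop. 5.8.1, Cor. 5.8.2 (held copy `book:gouvea1993-p-adic-numbers`,
  PDF pp. 120–127). [Gouvea1993PadicNumbers]
-/

noncomputable section

open Filter Topology

namespace Literature.NumberTheory.LocalFields

variable {p : ℕ} [hp : Fact p.Prime]

/-! ### Binomial estimates on one-units -/

/-- `‖(1+t)^k − 1‖ ≤ ‖t‖` for `‖t‖ ≤ 1` (induction: `(1+t)^{k+1} − 1 = ((1+t)^k − 1)(1+t) + t`).
[Gouvêa 1993, §5.8 (one-units form a group)] [cite: Gouvea1993PadicNumbers, §5.8 Prop. 5.8.1 (PDF p. 127)] -/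
theorem norm_one_add_pow_sub_one_le {t : ℚ_[p]} (ht : ‖t‖ ≤ 1) (k : ℕ) :
    ‖(1 + t) ^ k - 1‖ ≤ ‖t‖ := by
  have h1t : ‖1 + t‖ ≤ 1 := by
    calc ‖1 + t‖ ≤ max ‖(1 : ℚ_[p])‖ ‖t‖ := Padic.nonarchimedean _ _
      _ ≤ 1 := max_le (by rw [norm_one]) ht
  induction k with
  | zero => simp
  | succ k ih =>
    have e : (1 + t) ^ (k + 1) - 1 = ((1 + t) ^ k - 1) * (1 + t) + t := by ring
    rw [e]
    calc ‖((1 + t) ^ k - 1) * (1 + t) + t‖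
        ≤ max ‖((1 + t) ^ k - 1) * (1 + t)‖ ‖t‖ := Padic.nonarchimedean _ _
      _ ≤ ‖t‖ := max_le (by
          rw [norm_mul]
          calc ‖(1 + t) ^ k - 1‖ * ‖1 + t‖ ≤ ‖t‖ * 1 :=
                mul_le_mul ih h1t (norm_nonneg _) (norm_nonneg _)
            _ = ‖t‖ := mul_one _) le_rfl

/-- `‖(1+t)^k − 1 − kt‖ ≤ ‖t‖²` for `‖t‖ ≤ 1`
(induction: `(1+t)^{k+1} − 1 − (k+1)t = ((1+t)^k − 1 − kt)(1+t) + k t²`).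
[Gouvêa 1993, §5.8] [cite: Gouvea1993PadicNumbers, §5.8 Prop. 5.8.1 (PDF p. 127)] -/
theorem norm_one_add_pow_sub_one_sub_le {t : ℚ_[p]} (ht : ‖t‖ ≤ 1) (k : ℕ) :
    ‖(1 + t) ^ k - 1 - k * t‖ ≤ ‖t‖ ^ 2 := by
  have h1t : ‖1 + t‖ ≤ 1 := by
    calc ‖1 + t‖ ≤ max ‖(1 : ℚ_[p])‖ ‖t‖ := Padic.nonarchimedean _ _
      _ ≤ 1 := max_le (by rw [norm_one]) ht
  induction k with
  | zero => simp
  | succ k ih =>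
    have e : (1 + t) ^ (k + 1) - 1 - ((k + 1 : ℕ) : ℚ_[p]) * t =
        ((1 + t) ^ k - 1 - k * t) * (1 + t) + k * t ^ 2 := by
      push_cast; ring
    rw [e]
    calc ‖((1 + t) ^ k - 1 - k * t) * (1 + t) + k * t ^ 2‖
        ≤ max ‖((1 + t) ^ k - 1 - k * t) * (1 + t)‖ ‖(k : ℚ_[p]) * t ^ 2‖ :=
          Padic.nonarchimedean _ _
      _ ≤ ‖t‖ ^ 2 := max_le (by
          rw [norm_mul]
          calc ‖(1 + t) ^ k - 1 - k * t‖ * ‖1 + t‖ ≤ ‖t‖ ^ 2 * 1 :=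
                mul_le_mul ih h1t (norm_nonneg _) (sq_nonneg _)
            _ = ‖t‖ ^ 2 := mul_one _) (by
          rw [norm_mul, norm_pow]
          calc ‖(k : ℚ_[p])‖ * ‖t‖ ^ 2 ≤ 1 * ‖t‖ ^ 2 :=
                mul_le_mul_of_nonneg_right (by exact_mod_cast Padic.norm_int_le_one (p := p) (k : ℤ)) (sq_nonneg _)
            _ = ‖t‖ ^ 2 := one_mul _)

/-- **`‖(1+t)^p − 1‖ ≤ p⁻¹‖t‖` for `‖t‖ ≤ p⁻¹`** (any prime `p`): `(1+t)^p − 1 = t·∑_{k<p}(1+t)^k` and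
`∑_{k<p}(1+t)^k = p + ∑_{k<p}((1+t)^k − 1)` has norm `≤ max(‖p‖, ‖t‖) = p⁻¹`.
[Gouvêa 1993, §5.8 (proof of Prop. 5.8.1)] [cite: Gouvea1993PadicNumbers, §5.8 Prop. 5.8.1 (PDF p. 127)] -/
theorem norm_one_add_pow_prime_sub_one_le {t : ℚ_[p]} (ht : ‖t‖ ≤ (p : ℝ)⁻¹) :
    ‖(1 + t) ^ p - 1‖ ≤ (p : ℝ)⁻¹ * ‖t‖ := by
  have hp1 : (1 : ℝ) < p := by exact_mod_cast hp.out.one_lt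
  have hpinv1 : (p : ℝ)⁻¹ ≤ 1 := inv_le_one_of_one_le₀ hp1.le
  have ht1 : ‖t‖ ≤ 1 := ht.trans hpinv1
  have hgeom : (1 + t) ^ p - 1 = t * ∑ k ∈ Finset.range p, (1 + t) ^ k := by
    have := geom_sum_mul (1 + t) p
    rw [add_sub_cancel_left] at this
    rw [← this, mul_comm]
  have hsum : ‖∑ k ∈ Finset.range p, (1 + t) ^ k‖ ≤ (p : ℝ)⁻¹ := by
    have e : ∑ k ∈ Finset.range p, (1 + t) ^ k =
        (p : ℚ_[p]) + ∑ k ∈ Finset.range p, ((1 + t) ^ k - 1) := by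
      rw [Finset.sum_sub_distrib, Finset.sum_const, Finset.card_range]
      simp
    rw [e]
    calc ‖(p : ℚ_[p]) + ∑ k ∈ Finset.range p, ((1 + t) ^ k - 1)‖
        ≤ max ‖(p : ℚ_[p])‖ ‖∑ k ∈ Finset.range p, ((1 + t) ^ k - 1)‖ :=
          Padic.nonarchimedean _ _
      _ ≤ (p : ℝ)⁻¹ := max_le (by rw [Padic.norm_p]) ?_
    exact IsUltrametricDist.norm_sum_le_of_forall_le_of_nonneg (inv_nonneg.mpr (by positivity))
      fun k _ => (norm_one_add_pow_sub_one_le ht1 k).trans ht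
  rw [hgeom, norm_mul, mul_comm]
  exact mul_le_mul_of_nonneg_right hsum (norm_nonneg _)

/-- **`‖(1+t)^p − 1‖ = p⁻¹‖t‖` for `‖t‖ ≤ p⁻¹` and `p ≠ 2`**: the sum `∑_{k<p}(1+t)^k` is
`p + (p(p−1)/2)t + O(t²)` and the correction has norm `< ‖p‖` (`‖t‖ ≤ p⁻¹`, `p` odd), so its norm
is exactly `‖p‖ = p⁻¹`. [Gouvêa 1993, §5.8 (Prop. 5.8.1 (ii): `log_p` is an ISOMETRY on `U_p`)]
[cite: Gouvea1993PadicNumbers, §5.8 Prop. 5.8.1 (ii) (PDF p. 127)] -/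
theorem norm_one_add_pow_prime_sub_one_eq (hp2 : p ≠ 2) {t : ℚ_[p]} (ht : ‖t‖ ≤ (p : ℝ)⁻¹) :
    ‖(1 + t) ^ p - 1‖ = (p : ℝ)⁻¹ * ‖t‖ := by
  have hp1 : (1 : ℝ) < p := by exact_mod_cast hp.out.one_lt
  have hp0 : (0 : ℝ) < p := by positivity
  have hpinv1 : (p : ℝ)⁻¹ < 1 := inv_lt_one_of_one_lt₀ hp1
  have ht1 : ‖t‖ ≤ 1 := ht.trans hpinv1.le
  have hgeom : (1 + t) ^ p - 1 = t * ∑ k ∈ Finset.range p, (1 + t) ^ k := by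
    have := geom_sum_mul (1 + t) p
    rw [add_sub_cancel_left] at this
    rw [← this, mul_comm]
  -- `∑_{k<p} (1+t)^k = p + (∑_{k<p} k) t + ∑_{k<p} ((1+t)^k - 1 - k t)`
  have e : ∑ k ∈ Finset.range p, (1 + t) ^ k =
      (p : ℚ_[p]) + ((∑ k ∈ Finset.range p, (k : ℚ_[p])) * t +
        ∑ k ∈ Finset.range p, ((1 + t) ^ k - 1 - k * t)) := by
    rw [Finset.sum_mul, ← Finset.sum_add_distrib]
    have : ∀ k ∈ Finset.range p, (k : ℚ_[p]) * t + ((1 + t) ^ k - 1 - k * t) = (1 + t) ^ k - 1 :=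
      fun k _ => by ring
    rw [Finset.sum_congr rfl this, Finset.sum_sub_distrib, Finset.sum_const, Finset.card_range]
    simp
  -- the correction has norm `< p⁻¹`
  have hcorr : ‖(∑ k ∈ Finset.range p, (k : ℚ_[p])) * t +
      ∑ k ∈ Finset.range p, ((1 + t) ^ k - 1 - k * t)‖ < (p : ℝ)⁻¹ := by
    have hA : ‖(∑ k ∈ Finset.range p, (k : ℚ_[p])) * t‖ < (p : ℝ)⁻¹ := by
      -- `∑_{k<p} k = p (p-1)/2` and `2` is a unit for `p ≠ 2`
      have hs : (∑ k ∈ Finset.range p, (k : ℚ_[p])) * 2 = (p : ℚ_[p]) * ((p : ℚ_[p]) - 1) := by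
        have h := Finset.sum_range_id_mul_two p
        have h' : ((∑ k ∈ Finset.range p, k : ℕ) : ℚ_[p]) * 2 = ((p * (p - 1) : ℕ) : ℚ_[p]) := by
          exact_mod_cast h
        rw [Nat.cast_sum] at h'
        rw [h', Nat.cast_mul, Nat.cast_sub hp.out.one_lt.le, Nat.cast_one]
      have h2 : ‖(2 : ℚ_[p])‖ = 1 := by
        have : ((2 : ℕ) : ℚ_[p]) = 2 := by norm_num
        rw [← this, Padic.norm_natCast_eq_one_iff]
        exact (Nat.coprime_primes hp.out Nat.prime_two).mpr hp2
      have hnS : ‖∑ k ∈ Finset.range p, (k : ℚ_[p])‖ ≤ (p : ℝ)⁻¹ := by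
        have h' := congrArg (‖·‖) hs
        simp only [norm_mul, h2, mul_one] at h'
        rw [h', Padic.norm_p]
        calc (p : ℝ)⁻¹ * ‖(p : ℚ_[p]) - 1‖ ≤ (p : ℝ)⁻¹ * 1 := by
              gcongr
              calc ‖(p : ℚ_[p]) - 1‖ ≤ max ‖(p : ℚ_[p])‖ ‖(-1 : ℚ_[p])‖ := by
                    rw [sub_eq_add_neg]; exact Padic.nonarchimedean _ _
                _ ≤ 1 := max_le (by rw [Padic.norm_p]; exact hpinv1.le) (by rw [norm_neg, norm_one])
          _ = (p : ℝ)⁻¹ := mul_one _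
      rw [norm_mul]
      calc ‖∑ k ∈ Finset.range p, (k : ℚ_[p])‖ * ‖t‖ ≤ (p : ℝ)⁻¹ * (p : ℝ)⁻¹ :=
            mul_le_mul hnS ht (norm_nonneg _) (inv_nonneg.mpr hp0.le)
        _ < (p : ℝ)⁻¹ * 1 := by gcongr
        _ = (p : ℝ)⁻¹ := mul_one _
    have hB : ‖∑ k ∈ Finset.range p, ((1 + t) ^ k - 1 - k * t)‖ < (p : ℝ)⁻¹ := by
      have hle : ‖∑ k ∈ Finset.range p, ((1 + t) ^ k - 1 - k * t)‖ ≤ ‖t‖ ^ 2 :=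
        IsUltrametricDist.norm_sum_le_of_forall_le_of_nonneg (sq_nonneg _)
          fun k _ => norm_one_add_pow_sub_one_sub_le ht1 k
      refine hle.trans_lt ?_
      calc ‖t‖ ^ 2 ≤ (p : ℝ)⁻¹ ^ 2 := by gcongr
        _ < (p : ℝ)⁻¹ := by
            rw [sq]
            exact mul_lt_of_lt_one_right (inv_pos.mpr hp0) hpinv1
    calc _ ≤ max ‖(∑ k ∈ Finset.range p, (k : ℚ_[p])) * t‖
          ‖∑ k ∈ Finset.range p, ((1 + t) ^ k - 1 - k * t)‖ := Padic.nonarchimedean _ _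
      _ < (p : ℝ)⁻¹ := max_lt hA hB
  have hsum : ‖∑ k ∈ Finset.range p, (1 + t) ^ k‖ = (p : ℝ)⁻¹ := by
    rw [e, IsUltrametricDist.norm_add_eq_max_of_norm_ne_norm, Padic.norm_p, max_eq_left hcorr.le]
    rw [Padic.norm_p]
    exact hcorr.ne'
  rw [hgeom, norm_mul, hsum, mul_comm]

/-- `‖(1+t)^{pⁿ} − 1‖ ≤ p⁻ⁿ‖t‖` for `‖t‖ ≤ p⁻¹` (iterate `norm_one_add_pow_prime_sub_one_le`).
[Gouvêa 1993, §5.8] [cite: Gouvea1993PadicNumbers, §5.8 Prop. 5.8.1 (PDF p. 127)] -/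
theorem norm_one_add_pow_prime_pow_sub_one_le {t : ℚ_[p]} (ht : ‖t‖ ≤ (p : ℝ)⁻¹) (n : ℕ) :
    ‖(1 + t) ^ p ^ n - 1‖ ≤ ((p : ℝ)⁻¹) ^ n * ‖t‖ := by
  have hp0 : (0 : ℝ) < p := by exact_mod_cast hp.out.pos
  have hpinv1 : (p : ℝ)⁻¹ ≤ 1 := inv_le_one_of_one_le₀ (by exact_mod_cast hp.out.one_lt.le)
  induction n with
  | zero => simp
  | succ n ih =>
    set s : ℚ_[p] := (1 + t) ^ p ^ n - 1 with hs
    have hs' : (1 + t) ^ p ^ (n + 1) = (1 + s) ^ p := by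
      rw [hs, add_sub_cancel, ← pow_mul, pow_succ]
    have hsn : ‖s‖ ≤ (p : ℝ)⁻¹ := by
      refine ih.trans ?_
      calc ((p : ℝ)⁻¹) ^ n * ‖t‖ ≤ 1 * (p : ℝ)⁻¹ :=
            mul_le_mul (pow_le_one₀ (inv_nonneg.mpr hp0.le) hpinv1) ht (norm_nonneg _) zero_le_one
        _ = (p : ℝ)⁻¹ := one_mul _
    rw [hs']
    calc ‖(1 + s) ^ p - 1‖ ≤ (p : ℝ)⁻¹ * ‖s‖ := norm_one_add_pow_prime_sub_one_le hsn
      _ ≤ (p : ℝ)⁻¹ * (((p : ℝ)⁻¹) ^ n * ‖t‖) := by gcongr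
      _ = ((p : ℝ)⁻¹) ^ (n + 1) * ‖t‖ := by ring

/-- `‖(1+t)^{pⁿ} − 1‖ = p⁻ⁿ‖t‖` for `‖t‖ ≤ p⁻¹`, `p ≠ 2`.
[Gouvêa 1993, §5.8 Prop. 5.8.1 (ii)] [cite: Gouvea1993PadicNumbers, §5.8 Prop. 5.8.1 (ii) (PDF p. 127)] -/
theorem norm_one_add_pow_prime_pow_sub_one_eq (hp2 : p ≠ 2) {t : ℚ_[p]} (ht : ‖t‖ ≤ (p : ℝ)⁻¹)
    (n : ℕ) : ‖(1 + t) ^ p ^ n - 1‖ = ((p : ℝ)⁻¹) ^ n * ‖t‖ := by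
  have hp0 : (0 : ℝ) < p := by exact_mod_cast hp.out.pos
  have hpinv1 : (p : ℝ)⁻¹ ≤ 1 := inv_le_one_of_one_le₀ (by exact_mod_cast hp.out.one_lt.le)
  induction n with
  | zero => simp
  | succ n ih =>
    set s : ℚ_[p] := (1 + t) ^ p ^ n - 1 with hs
    have hs' : (1 + t) ^ p ^ (n + 1) = (1 + s) ^ p := by
      rw [hs, add_sub_cancel, ← pow_mul, pow_succ]
    have hsn : ‖s‖ ≤ (p : ℝ)⁻¹ := by
      rw [ih]
      calc ((p : ℝ)⁻¹) ^ n * ‖t‖ ≤ 1 * (p : ℝ)⁻¹ :=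
            mul_le_mul (pow_le_one₀ (inv_nonneg.mpr hp0.le) hpinv1) ht (norm_nonneg _) zero_le_one
        _ = (p : ℝ)⁻¹ := one_mul _
    rw [hs', norm_one_add_pow_prime_sub_one_eq hp2 hsn, ih]
    ring

/-! ### The ball of one-units of level `1` is closed under products and powers -/

/-- One-units have norm `≤ 1`. [folklore] -/
private theorem norm_le_one_of_norm_sub_one_le {u : ℚ_[p]} (hu : ‖u - 1‖ ≤ (p : ℝ)⁻¹) :
    ‖u‖ ≤ 1 := by
  have hpinv1 : (p : ℝ)⁻¹ ≤ 1 := inv_le_one_of_one_le₀ (by exact_mod_cast hp.out.one_lt.le)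
  calc ‖u‖ = ‖(u - 1) + 1‖ := by rw [sub_add_cancel]
    _ ≤ max ‖u - 1‖ ‖(1 : ℚ_[p])‖ := Padic.nonarchimedean _ _
    _ ≤ 1 := max_le (hu.trans hpinv1) (by rw [norm_one])

/-- The ball `‖u − 1‖ ≤ p⁻¹` is closed under multiplication. [folklore] -/
private theorem norm_mul_sub_one_le {u v : ℚ_[p]} (hu : ‖u - 1‖ ≤ (p : ℝ)⁻¹)
    (hv : ‖v - 1‖ ≤ (p : ℝ)⁻¹) : ‖u * v - 1‖ ≤ (p : ℝ)⁻¹ := by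
  have e : u * v - 1 = (u - 1) * v + (v - 1) := by ring
  rw [e]
  calc ‖(u - 1) * v + (v - 1)‖ ≤ max ‖(u - 1) * v‖ ‖v - 1‖ := Padic.nonarchimedean _ _
    _ ≤ (p : ℝ)⁻¹ := max_le (by
        rw [norm_mul]
        calc ‖u - 1‖ * ‖v‖ ≤ (p : ℝ)⁻¹ * 1 :=
              mul_le_mul hu (norm_le_one_of_norm_sub_one_le hv) (norm_nonneg _)
                (inv_nonneg.mpr (by positivity))
          _ = (p : ℝ)⁻¹ := mul_one _) hv

/-- The ball `‖u − 1‖ ≤ p⁻¹` is closed under powers. [folklore] -/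
private theorem norm_pow_sub_one_le {u : ℚ_[p]} (hu : ‖u - 1‖ ≤ (p : ℝ)⁻¹) (k : ℕ) :
    ‖u ^ k - 1‖ ≤ (p : ℝ)⁻¹ := by
  induction k with
  | zero => simp [inv_nonneg.mpr (show (0 : ℝ) ≤ p by positivity)]
  | succ k ih => rw [pow_succ]; exact norm_mul_sub_one_le ih hu

/-! ### Rigidity of homomorphisms tangent to zero to second order -/

/-- **Additive rigidity.** Let `f : ℚ_p → ℚ_p` satisfy `f(uv) = f(u) + f(v)` for all `u, v` in the
ball `‖u − 1‖ ≤ p⁻¹` (a homomorphism `1 + pℤ_p → ℚ_p^+`) and `‖f(u)‖ ≤ K‖u − 1‖²` there. Then `f`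
vanishes on the ball: `pⁿ f(u) = f(u^{pⁿ})` has norm `≤ K‖u^{pⁿ} − 1‖² ≤ K p^{−2n}‖u − 1‖²`, so
`‖f(u)‖ ≤ K p^{−n}‖u − 1‖²` for every `n`. (Standard: a continuous homomorphism `U₁ → ℚ_p` is a
multiple of `log_p`, Gouvêa Prop. 5.8.1, and one tangent to zero is zero.)
[Gouvêa 1993, §5.8 Prop. 5.8.1] [cite: Gouvea1993PadicNumbers, §5.8 Prop. 5.8.1 (PDF p. 127)] -/
theorem eq_zero_of_mul_hom_of_norm_le_sq (f : ℚ_[p] → ℚ_[p]) (K : ℝ)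
    (hmul : ∀ u v : ℚ_[p], ‖u - 1‖ ≤ (p : ℝ)⁻¹ → ‖v - 1‖ ≤ (p : ℝ)⁻¹ → f (u * v) = f u + f v)
    (hbd : ∀ u : ℚ_[p], ‖u - 1‖ ≤ (p : ℝ)⁻¹ → ‖f u‖ ≤ K * ‖u - 1‖ ^ 2)
    {u : ℚ_[p]} (hu : ‖u - 1‖ ≤ (p : ℝ)⁻¹) : f u = 0 := by
  have hp0 : (0 : ℝ) < p := by exact_mod_cast hp.out.pos
  have hpinv : (0 : ℝ) ≤ (p : ℝ)⁻¹ := inv_nonneg.mpr hp0.le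
  have hpinv1 : (p : ℝ)⁻¹ < 1 := inv_lt_one_of_one_lt₀ (by exact_mod_cast hp.out.one_lt)
  -- `f (u ^ k) = k • f u`
  have hpow : ∀ k : ℕ, f (u ^ k) = k * f u := by
    intro k
    induction k with
    | zero =>
      have h := hmul 1 1 (by simp [hpinv]) (by simp [hpinv])
      rw [mul_one] at h
      have h1 : f 1 = 0 := by linear_combination -h
      rw [pow_zero, h1, Nat.cast_zero, zero_mul]
    | succ k ih =>
      rw [pow_succ, hmul _ _ (norm_pow_sub_one_le hu k) hu, ih]
      push_cast
      ring
  -- the estimate `‖f u‖ ≤ K p^{-n} ‖u - 1‖²`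
  have hK : 0 ≤ K ∨ f u = 0 := by
    by_cases h0 : f u = 0
    · exact Or.inr h0
    · left
      have h := hbd u hu
      have hpos : 0 < ‖f u‖ := norm_pos_iff.mpr h0
      nlinarith [sq_nonneg ‖u - 1‖, norm_nonneg (u - 1)]
  rcases hK with hK | h0
  swap
  · exact h0
  have hest : ∀ n : ℕ, ‖f u‖ ≤ K * ((p : ℝ)⁻¹) ^ n * ‖u - 1‖ ^ 2 := by
    intro n
    have h1 := hbd (u ^ p ^ n) (norm_pow_sub_one_le hu _)
    rw [hpow, norm_mul] at h1
    have hpn : ‖((p ^ n : ℕ) : ℚ_[p])‖ = ((p : ℝ)⁻¹) ^ n := by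
      rw [Nat.cast_pow, norm_pow, Padic.norm_p]
    rw [hpn] at h1
    set t := u - 1 with htdef
    have hut : u = 1 + t := by rw [htdef]; ring
    have h2 : ‖u ^ p ^ n - 1‖ ≤ ((p : ℝ)⁻¹) ^ n * ‖t‖ := by
      rw [hut]; exact norm_one_add_pow_prime_pow_sub_one_le (by rw [htdef]; exact hu) n
    have h3 : K * ‖u ^ p ^ n - 1‖ ^ 2 ≤ K * (((p : ℝ)⁻¹) ^ n * ‖t‖) ^ 2 := by gcongr
    have hppos : 0 < ((p : ℝ)⁻¹) ^ n := pow_pos (inv_pos.mpr hp0) n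
    have h4 : ((p : ℝ)⁻¹) ^ n * ‖f u‖ ≤ ((p : ℝ)⁻¹) ^ n * (K * ((p : ℝ)⁻¹) ^ n * ‖t‖ ^ 2) := by
      calc ((p : ℝ)⁻¹) ^ n * ‖f u‖ ≤ K * ‖u ^ p ^ n - 1‖ ^ 2 := h1
        _ ≤ K * (((p : ℝ)⁻¹) ^ n * ‖t‖) ^ 2 := h3
        _ = ((p : ℝ)⁻¹) ^ n * (K * ((p : ℝ)⁻¹) ^ n * ‖t‖ ^ 2) := by ring
    exact le_of_mul_le_mul_left h4 hppos
  -- let `n → ∞`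
  have hlim : Tendsto (fun n : ℕ => K * ((p : ℝ)⁻¹) ^ n * ‖u - 1‖ ^ 2) atTop (𝓝 0) := by
    have := (tendsto_pow_atTop_nhds_zero_of_lt_one hpinv hpinv1).const_mul K |>.mul_const
      (‖u - 1‖ ^ 2)
    simpa using this
  have hle : ‖f u‖ ≤ 0 := ge_of_tendsto' hlim hest
  exact norm_le_zero_iff.mp hle

/-- **Multiplicative rigidity** (`p ≠ 2`). Let `R : ℚ_p → ℚ_p` satisfy `R(uv) = R(u)R(v)` on the
ball `‖u − 1‖ ≤ p⁻¹`, with `‖R(u) − 1‖ ≤ p⁻¹` and `‖R(u) − 1‖ ≤ K‖u − 1‖²` there. Then `R ≡ 1` on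
the ball: with `r = R(u)`, `‖r^{pⁿ} − 1‖ = p⁻ⁿ‖r − 1‖` (`norm_one_add_pow_prime_pow_sub_one_eq`)
while `r^{pⁿ} = R(u^{pⁿ})` is within `K‖u^{pⁿ} − 1‖² ≤ Kp^{−2n}‖u − 1‖²` of `1`.
[Gouvêa 1993, §5.8 Prop. 5.8.1 (ii) (`U_p ≅ ℤ_p^+` is torsion-free)]
[cite: Gouvea1993PadicNumbers, §5.8 Prop. 5.8.1 (ii) (PDF p. 127)] -/
theorem eq_one_of_mul_hom_of_norm_sub_one_le_sq (hp2 : p ≠ 2) (R : ℚ_[p] → ℚ_[p]) (K : ℝ)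
    (hmul : ∀ u v : ℚ_[p], ‖u - 1‖ ≤ (p : ℝ)⁻¹ → ‖v - 1‖ ≤ (p : ℝ)⁻¹ → R (u * v) = R u * R v)
    (hone : ∀ u : ℚ_[p], ‖u - 1‖ ≤ (p : ℝ)⁻¹ → ‖R u - 1‖ ≤ (p : ℝ)⁻¹)
    (hbd : ∀ u : ℚ_[p], ‖u - 1‖ ≤ (p : ℝ)⁻¹ → ‖R u - 1‖ ≤ K * ‖u - 1‖ ^ 2)
    {u : ℚ_[p]} (hu : ‖u - 1‖ ≤ (p : ℝ)⁻¹) : R u = 1 := by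
  have hp0 : (0 : ℝ) < p := by exact_mod_cast hp.out.pos
  have hpinv : (0 : ℝ) ≤ (p : ℝ)⁻¹ := inv_nonneg.mpr hp0.le
  have hpinv1 : (p : ℝ)⁻¹ < 1 := inv_lt_one_of_one_lt₀ (by exact_mod_cast hp.out.one_lt)
  -- `R (u ^ k) = (R u) ^ k` for `k ≥ 1` (we avoid `k = 0`, where `R 1 = 1` would be needed)
  have hpow : ∀ k : ℕ, R (u ^ (k + 1)) = R u ^ (k + 1) := by
    intro k
    induction k with
    | zero => simp
    | succ k ih => rw [pow_succ, hmul _ _ (norm_pow_sub_one_le hu _) hu, ih, ← pow_succ]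
  set r := R u with hrdef
  have hr : ‖r - 1‖ ≤ (p : ℝ)⁻¹ := hone u hu
  have hK : 0 ≤ K ∨ r = 1 := by
    by_cases h0 : r = 1
    · exact Or.inr h0
    · left
      have h := hbd u hu
      have hpos : 0 < ‖R u - 1‖ := norm_pos_iff.mpr (sub_ne_zero.mpr h0)
      nlinarith [sq_nonneg ‖u - 1‖, norm_nonneg (u - 1)]
  rcases hK with hK | h0
  swap
  · exact h0
  have hest : ∀ n : ℕ, ‖r - 1‖ ≤ K * ((p : ℝ)⁻¹) ^ n * ‖u - 1‖ ^ 2 := by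
    intro n
    have hpn1 : p ^ n = (p ^ n - 1) + 1 := (Nat.sub_add_cancel (Nat.one_le_pow n p hp.out.pos)).symm
    have h1 := hbd (u ^ p ^ n) (norm_pow_sub_one_le hu _)
    rw [hpn1, hpow, ← hpn1] at h1
    -- `‖r ^ p ^ n - 1‖ = p^{-n} ‖r - 1‖`
    set s := r - 1 with hsdef
    have hrs : r = 1 + s := by rw [hsdef]; ring
    have h2 : ‖r ^ p ^ n - 1‖ = ((p : ℝ)⁻¹) ^ n * ‖s‖ := by
      rw [hrs]; exact norm_one_add_pow_prime_pow_sub_one_eq hp2 (by rw [hsdef]; exact hr) n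
    set t := u - 1 with htdef
    have hut : u = 1 + t := by rw [htdef]; ring
    have h3 : ‖u ^ p ^ n - 1‖ ≤ ((p : ℝ)⁻¹) ^ n * ‖t‖ := by
      rw [hut]; exact norm_one_add_pow_prime_pow_sub_one_le (by rw [htdef]; exact hu) n
    rw [h2] at h1
    have h4 : K * ‖u ^ p ^ n - 1‖ ^ 2 ≤ K * (((p : ℝ)⁻¹) ^ n * ‖t‖) ^ 2 := by gcongr
    have hppos : 0 < ((p : ℝ)⁻¹) ^ n := pow_pos (inv_pos.mpr hp0) n
    have h5 : ((p : ℝ)⁻¹) ^ n * ‖s‖ ≤ ((p : ℝ)⁻¹) ^ n * (K * ((p : ℝ)⁻¹) ^ n * ‖t‖ ^ 2) := by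
      calc ((p : ℝ)⁻¹) ^ n * ‖s‖ ≤ K * ‖u ^ p ^ n - 1‖ ^ 2 := h1
        _ ≤ K * (((p : ℝ)⁻¹) ^ n * ‖t‖) ^ 2 := h4
        _ = ((p : ℝ)⁻¹) ^ n * (K * ((p : ℝ)⁻¹) ^ n * ‖t‖ ^ 2) := by ring
    exact le_of_mul_le_mul_left h5 hppos
  have hlim : Tendsto (fun n : ℕ => K * ((p : ℝ)⁻¹) ^ n * ‖u - 1‖ ^ 2) atTop (𝓝 0) := by
    have := (tendsto_pow_atTop_nhds_zero_of_lt_one hpinv hpinv1).const_mul K |>.mul_const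
      (‖u - 1‖ ^ 2)
    simpa using this
  have hle : ‖r - 1‖ ≤ 0 := ge_of_tendsto' hlim hest
  exact sub_eq_zero.mp (norm_le_zero_iff.mp hle)

end Literature.NumberTheory.LocalFields

end
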